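/-
Origin: expansion seat `planner-pub-hodgecm-pv03-g6-0`, handover #7 v2 2026-08-18T11:09:41Z (`HOME/pub-hodgecm-pv03-g6/lean/Pv03g6/TwistedNormSep.lean`, md5 309def62, 88 lines);
landed by the gen-7 packager in gate run 28 as `HodgeCM/Model/Toy/TwistedNormSep.lean` (import ^import Pv03g6\.TwistedTypeNorm\b→import HodgeCM.Model.Toy.TwistedTypeNorm ×1).
-/
/-
Origin: pub-hodgecm-pv03-g6 (DAG-NODE PROVER #03, gen 6), 2026-08-18. WIP module `Pv03g6.TwistedNormSep`, final module
`HodgeCM.Model.Toy.TwistedNormSep`; used by `HodgeCM.Model.ToyG2.SplitAllGood` (toy-g2's `SplitInput` for ALL good objects;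
memo `HOME/pub-hodgecm-pv03-g6/SPLIT-ALL-GOOD.md`).

# Choosing `α` so that the eigenvalues of `⋀ᵏ (tnorm α)` separate twisted type vectors

For `β` a primitive element of the Galois hull `N` (so that `δ ↦ δ β` is injective on `Gal(N/ℚ)`,
`exists_primitive`) and `α = x - β` with `x ∈ ℚ` outside a finite exceptional set, the map
`t ↦ ∏_δ (δ α) ^ t δ` is injective on any prescribed finite set of exponent vectors `t : Gal(N/ℚ) → ℕ`
(`exists_sep_param`): the polynomials `∏_δ (T - δβ)^{t δ} ∈ N[T]` are pairwise distinct (their root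
multisets differ), so they take pairwise distinct values at all but finitely many rational points.
-/
import Mathlib
import Summits.HodgeConjecture.HodgeCM.Model.Toy.TwistedTypeNorm_2

/-! PORT of `HodgeCM/Model/Toy/TwistedNormSep.lean` (HodgeCMPerL run 82) — verbatim mechanical port; provenance in the PORT header line. -/

noncomputable section

open Polynomial

namespace HodgeCM.Toy

namespace Obj

variable (X : Obj)

attribute [local instance] Classical.propDecidable

/-- a primitive element of the Galois hull on which the Galois group acts freely -/
theorem exists_primitive : ∃ β : X.N, Function.Injective fun δ : X.G => δ β := by
  obtain ⟨β, hβ⟩ := Field.exists_primitive_element ℚ X.N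
  have hA : ∀ x : X.N, ((minpoly ℚ x).map (algebraMap ℚ X.N)).Splits :=
    fun x => Normal.splits inferInstance x
  have hinj := (Field.primitive_element_iff_algHom_eq_of_eval' ℚ X.N hA β).mp hβ
  exact ⟨β, fun δ δ' h => AlgEquiv.coe_toAlgHom_injective (hinj h)⟩

/-- `∏_δ (T - δ β) ^ t δ ∈ N[T]` -/
def sepPol (β : X.N) (t : X.G → ℕ) : X.N[X] := ∏ δ : X.G, (Polynomial.X - C (δ β)) ^ t δ

/-- (Ported verbatim from the HodgeCMPerL package; no docstring in the source.) -/
lemma sepPol_ne_zero (β : X.N) (t : X.G → ℕ) : X.sepPol β t ≠ 0 :=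
  Finset.prod_ne_zero_iff.mpr fun _ _ => pow_ne_zero _ (X_sub_C_ne_zero _)

/-- (Ported verbatim from the HodgeCMPerL package; no docstring in the source.) -/
lemma count_roots_sepPol (β : X.N) (hβ : Function.Injective fun δ : X.G => δ β) (t : X.G → ℕ) (δ₀ : X.G) :
    (X.sepPol β t).roots.count (δ₀ β) = t δ₀ := by
  rw [sepPol, roots_prod _ _ (X.sepPol_ne_zero β t), Multiset.count_bind]
  simp only [roots_pow, roots_X_sub_C, Multiset.count_nsmul, Multiset.count_singleton]
  rw [← Finset.sum_eq_multiset_sum]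
  have h : ∀ δ : X.G, (t δ * if δ₀ β = δ β then 1 else 0) = if δ₀ = δ then t δ else 0 := by
    intro δ
    by_cases e : δ₀ = δ
    · subst e; simp
    · rw [if_neg e, if_neg (fun e' => e (hβ e')), mul_zero]
  rw [Finset.sum_congr rfl (fun δ _ => h δ), Finset.sum_ite_eq]
  simp

/-- (Ported verbatim from the HodgeCMPerL package; no docstring in the source.) -/
lemma sepPol_injective (β : X.N) (hβ : Function.Injective fun δ : X.G => δ β) :
    Function.Injective (X.sepPol β) := by
  intro t t' h
  funext δ₀
  rw [← X.count_roots_sepPol β hβ t δ₀, ← X.count_roots_sepPol β hβ t' δ₀, h]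

/-- (Ported verbatim from the HodgeCMPerL package; no docstring in the source.) -/
lemma eval_sepPol (β : X.N) (t : X.G → ℕ) (x : ℚ) :
    (X.sepPol β t).eval (algebraMap ℚ X.N x) = ∏ δ : X.G, (δ (algebraMap ℚ X.N x - β)) ^ t δ := by
  rw [sepPol, eval_prod]
  refine Finset.prod_congr rfl (fun δ _ => ?_)
  rw [eval_pow, eval_sub, eval_X, eval_C, map_sub, AlgEquiv.commutes]

/-- **Separation.** Outside a finite set of rational parameters `x`, the products
`∏_δ (δ (x - β)) ^ t δ` separate the exponent vectors of any finite family `T`. -/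
theorem exists_sep_param (β : X.N) (hβ : Function.Injective fun δ : X.G => δ β) (T : Finset (X.G → ℕ)) :
    ∃ x : ℚ, algebraMap ℚ X.N x - β ≠ 0 ∧ ∀ t ∈ T, ∀ t' ∈ T,
      (∏ δ : X.G, (δ (algebraMap ℚ X.N x - β)) ^ t δ) = (∏ δ : X.G, (δ (algebraMap ℚ X.N x - β)) ^ t' δ) →
        t = t' := by
  let bad : Finset X.N := insert β (T.biUnion fun t => T.biUnion fun t' =>
    (X.sepPol β t - X.sepPol β t').roots.toFinset)
  obtain ⟨x, hx⟩ := Infinite.exists_notMem_finset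
    (bad.preimage (algebraMap ℚ X.N) (algebraMap ℚ X.N).injective.injOn)
  rw [Finset.mem_preimage] at hx
  refine ⟨x, fun h => hx (by rw [sub_eq_zero.mp h]; exact Finset.mem_insert_self _ _), fun t ht t' ht' h => ?_⟩
  by_contra hne
  apply hx
  refine Finset.mem_insert_of_mem (Finset.mem_biUnion.mpr ⟨t, ht, Finset.mem_biUnion.mpr ⟨t', ht', ?_⟩⟩)
  rw [Multiset.mem_toFinset, mem_roots (sub_ne_zero.mpr fun e => hne (X.sepPol_injective β hβ e)), IsRoot,
    eval_sub, eval_sepPol, eval_sepPol, h, sub_self]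

end Obj

end HodgeCM.Toy
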